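import Summits.SmoothPoincare4.SmoothPoincare4.Theses.SymplecticOrigami
import Summits.SmoothPoincare4.SmoothPoincare4.Theorems.SymplecticOrigamiGromovRecognitionRelEndStubTameJAux
import Summits.SmoothPoincare4.SmoothPoincare4.Theorems.SymplecticOrigamiGromovRecognitionRelEndStubTameJAux2
import Summits.SmoothPoincare4.SmoothPoincare4.Theorems.SymplecticOrigamiGromovRecognitionRelEndStubTameJAux4
import Summits.SmoothPoincare4.SmoothPoincare4.Theorems.SymplecticOrigamiGromovRecognitionRelEndStubTameJAux5
import Summits.SmoothPoincare4.SmoothPoincare4.Theorems.SymplecticOrigamiGromovRecognitionRelEndStubTameJAux6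
import Summits.SmoothPoincare4.SmoothPoincare4.Theorems.SymplecticOrigamiGromovRecognitionRelEndStubEndDoesNotReturnAux
import Literature.Geometry.Symplectic.AlmostComplexStructure
import Literature.Geometry.Symplectic.GromovR4RelEndProofs
import Literature.Geometry.Symplectic.SteinBall
import Literature.Geometry.Kaehler.ManifoldFormsChart
import Literature.Geometry.Kaehler.FubiniStudy
import Literature.Geometry.Riemannian.RiemannianMetricExists
import Mathlib
import HarnessLib

/-!
# Stub `stub_tameJ` of line `cross-cap-laurent` (crux `GromovRecognitionRelEnd`,
item stmt-SmoothPoincare4-11009): an `sf`-tame almost complex structure, integrable on a sub-end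

**Statement** (`stub_tameJ`, registered verbatim; Wendl (2018) Exercise 6.7 / McDuff–Salamon (2017)
§4.1 "the space of `ω`-tame `J` is non-empty and contractible", made relative to the end). Under
the end hypotheses of the crux — `sf` a smooth `2`-form on the `4`-manifold `M`, nondegenerate
(H4), with all sub-ends `K ∪ {‖ψ‖ ≤ R'}` compact (H5), `ψ` smooth on `Kᶜ` (H6) and a bijection onto
`{R < ‖z‖}` (H8), `sf = ψ*ω₀` on `Kᶜ` (H10), and the truncations `K ∪ {‖ψ‖ < R'}` open (the
conclusion of the neighbouring stub `stub_endDoesNotReturn`, a hypothesis here) — there are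
`R₁ > max R 0` and a `C^∞` almost complex structure `J` on `M`, TAMED by `sf`, with
`dψ ∘ J = (i ⊕ i) ∘ dψ` at every point of the sub-end `{x ∈ Kᶜ | R₁ < ‖ψ x‖}`.

**Proof** (`R₁ := max R 0 + 2`).
1. `K` is closed (H5 at `R' = R` + H8), `dψ_x` is injective for `x ∈ Kᶜ` (H4 + H10), so the end
   structure `J_ψ := (dψ)⁻¹ (i ⊕ i) dψ` is a smooth section of `End(TM)` over the open `Kᶜ`
   (`contMDiffOn_endPullback`), `sf`-COMPATIBLE there by H10 (`form_pullbackJ_eq_inner`: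
   `sf(v, J_ψ w) = ⟪dψ v, dψ w⟫`).
2. A global `C^∞` section `A` of `End(TM)` with `g_A := sf(·, A ·)` symmetric positive definite
   everywhere and `A = J_ψ` on `F := {x ∈ Kᶜ | max R 0 + 1 ≤ ‖ψ x‖}` is produced by Mathlib's
   partition-of-unity gluing under CONVEX fibrewise constraints
   (`exists_contMDiffSection_forall_mem_convex_of_local`): the local sections are `J_ψ` on the
   open `U₁ = {x ∈ Kᶜ | max R 0 + 1/2 < ‖ψ x‖}` and, on the open `U₀ = K ∪ {‖ψ‖ < max R 0 + 1}`
   (hypothesis `hopen`; `U₀ ∩ F = ∅`), the chart transposes of `sf` (`contMDiffOn_chartTranspose`,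
   `form_chartTranspose_apply`).
3. `J := F(A, τ(A), p(A))`, the explicit four-dimensional polar part `A(-A²)^{-1/2}`
   (McDuff–Salamon (2017), Prop. 2.5.6 / (4.1.3)): pointwise `J² = -1` and `sf(v, Jv) > 0`
   (`polar_spec`), smooth as a section because `F` is conjugation-equivariant and smooth
   (`contMDiff_endSection_map`, `polar_conj`, `contDiffAt_polar`), and `J = J_ψ` on `F ⊇ {R₁ < ‖ψ‖}`
   since `J_ψ² = -1` is fixed by the retraction (`polar_of_mul_self`); there
   `dψ (J v) = (i ⊕ i)(dψ v)` (`apply_pullbackJ`).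
Why `R₁ > R` strictly: `ψ*(i ⊕ i)` need not extend to `∂K` (Disproof §7, `TwistEnd`). H10 is what
makes `J_ψ` tame (Disproof `_false_without_pullback`); H4 is needed (`_false_without_nondegenerate`).

References: D. McDuff, D. Salamon, *Introduction to Symplectic Topology*, 3rd ed. (2017),
Prop. 2.5.6, §4.1 [McDuffSalamon2017]; C. Wendl, *Holomorphic Curves in Low Dimensions* (2018),
Exercise 6.7 [Wendl2018].
-/

noncomputable section

-- the prescribed namespace `Summit.<P>.<Sub>.…` duplicates `SmoothPoincare4` (P = Sub)
set_option linter.dupNamespace false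

open scoped Manifold ContDiff Topology RealInnerProductSpace
open Set TopologicalSpace Bundle Literature.Geometry.Kaehler Literature.Geometry.Symplectic

/-- Model space `ℝ⁴ = ℂ²` (coordinates `0,1` = `z₁`, `2,3` = `z₂`). -/
local notation "E4" => EuclideanSpace ℝ (Fin 4)
/-- `ℝ² = ℂ`, the coordinate plane of one factor. -/
local notation "E2" => EuclideanSpace ℝ (Fin 2)

namespace Summit.SmoothPoincare4.SmoothPoincare4.Theorems.GromovRecognitionRelEnd.CrossCapLaurent

/-! ## Structure forced by the end hypotheses (adapted from the Disproof file, §2; `K` closed is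
the sibling file's `isClosed_of_ends`) -/

section Structure

variable {M : Type} [TopologicalSpace M]

variable [ChartedSpace E4 M]

/-- H4 + H10 force `dψ_x` to be injective at every point of `Kᶜ`. [folklore] -/
theorem mfderiv_injective_of_pullback {sf : MForm (𝓡 4) M ℝ 2} {K : Set M} {ψ : M → E4}
    (h4 : ∀ x (v : TangentSpace (𝓡 4) x), v ≠ 0 → ∃ w, sf x ![v, w] ≠ 0)
    (h10 : ∀ x, x ∈ Kᶜ → ∀ v w, sf x ![v, w] =
      stdSymplecticForm (mfderiv (𝓡 4) 𝓘(ℝ, E4) ψ x v) (mfderiv (𝓡 4) 𝓘(ℝ, E4) ψ x w))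
    {x : M} (hx : x ∈ Kᶜ) : Function.Injective (mfderiv (𝓡 4) 𝓘(ℝ, E4) ψ x) := by
  -- adapted from Cruxes/GromovRecognitionRelEnd/Disproof.lean (mfderiv_injective_of_pullbackClause)
  rw [injective_iff_map_eq_zero]
  intro v hv
  by_contra hv0
  obtain ⟨w, hw⟩ := h4 x v hv0
  rw [h10 x hx v w, hv] at hw
  have h0 : ∀ b : E4, stdSymplecticForm 0 b = 0 := fun b ↦ by simp [stdSymplecticForm]
  exact hw (h0 _)

/-- **Convexity of the fibrewise constraint** "`sf_x(·, A ·)` is symmetric positive definite and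
`A` is prescribed when `P` holds" (the pointwise step of the partition-of-unity argument: a convex
combination of Riemannian pairings is one). [cite: McDuffSalamon2017, §4.1] -/
theorem convex_tameConstraint (sf : MForm (𝓡 4) M ℝ 2) (x : M) (P : Prop)
    (c : TangentSpace (𝓡 4) x →L[ℝ] TangentSpace (𝓡 4) x) :
    Convex ℝ {A : TangentSpace (𝓡 4) x →L[ℝ] TangentSpace (𝓡 4) x |
      (∀ v w : TangentSpace (𝓡 4) x, sf x ![v, A w] = sf x ![w, A v]) ∧
      (∀ v : TangentSpace (𝓡 4) x, v ≠ 0 → 0 < sf x ![v, A v]) ∧ (P → A = c)} := by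
  rintro A₁ ⟨h1s, h1p, h1c⟩ A₂ ⟨h2s, h2p, h2c⟩ a b ha hb hab
  have hlin : ∀ v w : TangentSpace (𝓡 4) x,
      sf x ![v, (a • A₁ + b • A₂) w] = a * sf x ![v, A₁ w] + b * sf x ![v, A₂ w] := by
    intro v w
    show sf x ![v, a • A₁ w + b • A₂ w] = _
    rw [cam₂_add_right, cam₂_smul_right, cam₂_smul_right, smul_eq_mul, smul_eq_mul]
  refine ⟨fun v w ↦ by rw [hlin, hlin, h1s, h2s], fun v hv ↦ ?_, fun hP ↦ ?_⟩
  · rw [hlin]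
    have h1 := h1p v hv
    have h2 := h2p v hv
    rcases ha.eq_or_lt with rfl | ha'
    · rw [zero_add] at hab
      rw [hab]
      linarith
    · nlinarith
  · rw [h1c hP, h2c hP, ← add_smul, hab, one_smul]

end Structure

/-! ## The stub -/

set_option maxHeartbeats 1600000 in
set_option synthInstance.maxHeartbeats 400000 in
-- the partition-of-unity lemma on the endomorphism bundle needs large instance searches
/-- **Stub 2 — an `sf`-tame `J`, integrable (`= ψ*(i ⊕ i)`) on a sub-end** (Wendl (2018)
Exercise 6.7 and McDuff–Salamon (2017) §4.1 "the space of tame `J` is contractible and non-empty",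
made relative to the end). There are `R₁ > max R 0` and a `C^∞` almost complex structure `J` on
`M`, tamed by `sf`, with `dψ ∘ J = (i ⊕ i) ∘ dψ` at every point of the sub-end
`{x ∈ Kᶜ | R₁ < ‖ψ x‖}`. See the module docstring for the proof.
[cite: McDuffSalamon2017, §4.1; Wendl2018, Exercise 6.7] -/
theorem stub_tameJ :
    ∀ (M : Type) [TopologicalSpace M] [T2Space M] [SecondCountableTopology M]
      [ChartedSpace E4 M] [IsManifold (𝓡 4) ∞ M]
      (sf : MForm (𝓡 4) M ℝ 2) (K : Set M) (R : ℝ) (ψ : M → E4),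
      IsSmoothForm sf →
      (∀ x (v : TangentSpace (𝓡 4) x), v ≠ 0 → ∃ w, sf x ![v, w] ≠ 0) →
      (∀ R', R ≤ R' → IsCompact (K ∪ {x | ‖ψ x‖ ≤ R'})) →
      ContMDiffOn (𝓡 4) 𝓘(ℝ, E4) ∞ ψ Kᶜ →
      Set.BijOn ψ Kᶜ (Metric.closedBall (0 : E4) R)ᶜ →
      (∀ x, x ∈ Kᶜ → ∀ v w, sf x ![v, w] =
        stdSymplecticForm (mfderiv (𝓡 4) 𝓘(ℝ, E4) ψ x v) (mfderiv (𝓡 4) 𝓘(ℝ, E4) ψ x w)) →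
      (∀ R', R < R' → IsOpen (K ∪ {x | x ∈ Kᶜ ∧ ‖ψ x‖ < R'})) →
      ∃ (R₁ : ℝ) (J : AlmostComplexStructure (𝓡 4) ∞ M), R < R₁ ∧ 0 < R₁ ∧ J.IsTamedBy sf ∧
        ∀ x, x ∈ Kᶜ → R₁ < ‖ψ x‖ → ∀ (v : TangentSpace (𝓡 4) x) (a : E4),
          a = mfderiv (𝓡 4) 𝓘(ℝ, E4) ψ x v →
          mfderiv (𝓡 4) 𝓘(ℝ, E4) ψ x (J x v) = WithLp.toLp 2 ![-(a 1), a 0, -(a 3), a 2] := by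
  intro M _ _ _ _ _ sf K R ψ h2 h4 h5 h6 h8 h10 hopen
  -- σ-compactness (for partitions of unity)
  haveI : LocallyCompactSpace M := ChartedSpace.locallyCompactSpace E4 M
  haveI : SigmaCompactSpace M := sigmaCompactSpace_of_locallyCompact_secondCountable
  -- radii
  have hR0 : R ≤ max R 0 := le_max_left _ _
  have h00 : (0 : ℝ) ≤ max R 0 := le_max_right _ _
  -- `K` closed, `Kᶜ` open, `dψ` injective on `Kᶜ`
  have hKc : IsClosed K := isClosed_of_ends h5 h8.mapsTo
  have hKo : IsOpen Kᶜ := hKc.isOpen_compl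
  have hinj : ∀ x ∈ Kᶜ, Function.Injective (mfderiv (𝓡 4) 𝓘(ℝ, E4) ψ x) :=
    fun x hx ↦ mfderiv_injective_of_pullback h4 h10 hx
  have hinv : ∀ x ∈ Kᶜ, (mfderiv (𝓡 4) 𝓘(ℝ, E4) ψ x : E4 →L[ℝ] E4).IsInvertible :=
    fun x hx ↦ isInvertible_of_injective _ (hinj x hx)
  -- the two open sets and the far set
  set U₁ : Set M := Kᶜ ∩ ψ ⁻¹' {z : E4 | max R 0 + 1 / 2 < ‖z‖} with hU₁
  set F : Set M := {x | x ∈ Kᶜ ∧ max R 0 + 1 ≤ ‖ψ x‖} with hF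
  have hU₁o : IsOpen U₁ :=
    (h6.continuousOn).isOpen_inter_preimage hKo (isOpen_lt continuous_const continuous_norm)
  have hU₀o : IsOpen (K ∪ {x | x ∈ Kᶜ ∧ ‖ψ x‖ < max R 0 + 1}) := hopen _ (by linarith)
  have hU₀F : ∀ x, x ∈ K ∪ {x | x ∈ Kᶜ ∧ ‖ψ x‖ < max R 0 + 1} → x ∉ F := by
    rintro x (hxK | ⟨-, hx⟩) ⟨hxK', hx'⟩
    · exact hxK' hxK
    · linarith
  -- the end structure `J_ψ = (dψ)⁻¹ (i ⊕ i) dψ` and its compatibility on `Kᶜ`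
  have hJψ_sym : ∀ x ∈ Kᶜ, ∀ v w : TangentSpace (𝓡 4) x,
      sf x ![v, ((mfderiv (𝓡 4) 𝓘(ℝ, E4) ψ x : E4 →L[ℝ] E4).inverse.comp
        (stdComplexStructure.comp (mfderiv (𝓡 4) 𝓘(ℝ, E4) ψ x : E4 →L[ℝ] E4))) w] =
        ⟪(mfderiv (𝓡 4) 𝓘(ℝ, E4) ψ x : E4 →L[ℝ] E4) v, (mfderiv (𝓡 4) 𝓘(ℝ, E4) ψ x : E4 →L[ℝ] E4) w⟫ :=
    fun x hx v w ↦ form_pullbackJ_eq_inner (hinv x hx) (sf x) (h10 x hx) v w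
  -- **the global section `A`** (partition of unity under the convex constraint)
  obtain ⟨A, hA⟩ := exists_contMDiffSection_forall_mem_convex_of_local (n := ⊤) (𝓡 4)
    (fun x : M ↦ TangentSpace (𝓡 4) x →L[ℝ] TangentSpace (𝓡 4) x)
    (fun x ↦ {B : TangentSpace (𝓡 4) x →L[ℝ] TangentSpace (𝓡 4) x |
      (∀ v w : TangentSpace (𝓡 4) x, sf x ![v, B w] = sf x ![w, B v]) ∧
      (∀ v : TangentSpace (𝓡 4) x, v ≠ 0 → 0 < sf x ![v, B v]) ∧
      (x ∈ F → B = ((mfderiv (𝓡 4) 𝓘(ℝ, E4) ψ x : E4 →L[ℝ] E4).inverse.comp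
        (stdComplexStructure.comp (mfderiv (𝓡 4) 𝓘(ℝ, E4) ψ x : E4 →L[ℝ] E4))))})
    (fun x ↦ convex_tameConstraint sf x _ _) (fun x₀ ↦ by
      by_cases hx₀ : x₀ ∈ U₁
      · -- near the end: the section `J_ψ`
        refine ⟨U₁, hU₁o.mem_nhds hx₀, fun x ↦ ((mfderiv (𝓡 4) 𝓘(ℝ, E4) ψ x : E4 →L[ℝ] E4).inverse.comp
          (stdComplexStructure.comp (mfderiv (𝓡 4) 𝓘(ℝ, E4) ψ x : E4 →L[ℝ] E4))), ?_, ?_⟩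
        · exact contMDiffOn_endPullback hU₁o (h6.mono inter_subset_left) fun x hx ↦ hinj x hx.1
        · intro y hy
          refine ⟨fun v w ↦ ?_, fun v hv ↦ ?_, fun _ ↦ rfl⟩
          · rw [hJψ_sym y hy.1, hJψ_sym y hy.1, real_inner_comm]
          · rw [hJψ_sym y hy.1, real_inner_self_eq_norm_sq]
            have : (mfderiv (𝓡 4) 𝓘(ℝ, E4) ψ y : E4 →L[ℝ] E4) v ≠ 0 := fun h ↦
              hv (hinj y hy.1 (by rw [map_zero]; exact h))
            positivity
      · -- near `K`: the chart transpose of `sf`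
        have hx₀U₀ : x₀ ∈ K ∪ {x | x ∈ Kᶜ ∧ ‖ψ x‖ < max R 0 + 1} := by
          by_cases hK : x₀ ∈ K
          · exact Or.inl hK
          · refine Or.inr ⟨hK, ?_⟩
            have : ¬ (max R 0 + 1 / 2 < ‖ψ x₀‖) := fun h ↦ hx₀ ⟨hK, h⟩
            linarith
        refine ⟨(chartAt E4 x₀).source ∩ (K ∪ {x | x ∈ Kᶜ ∧ ‖ψ x‖ < max R 0 + 1}),
          ((chartAt E4 x₀).open_source.inter hU₀o).mem_nhds ⟨mem_chart_source E4 x₀, hx₀U₀⟩,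
          fun y ↦ ((trivializationAt E4 (TangentSpace (𝓡 4)) x₀).symmL ℝ y).comp
            ((∑ j : Fin 4, ((sf.inChart x₀ (extChartAt (𝓡 4) x₀ y)).toContinuousMultilinearMap
              |>.toContinuousLinearMap ![(0 : E4), EuclideanSpace.single j (1 : ℝ)] 0).smulRight
                (EuclideanSpace.single j (1 : ℝ))).comp
              ((trivializationAt E4 (TangentSpace (𝓡 4)) x₀).continuousLinearMapAt ℝ y)), ?_, ?_⟩
        · exact (contMDiffOn_chartTranspose sf h2 x₀).mono inter_subset_left
        · intro y hy
          refine ⟨fun v w ↦ ?_, fun v hv ↦ ?_, fun hyF ↦ absurd hyF (hU₀F y hy.2)⟩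
          · rw [form_chartTranspose_apply sf x₀ hy.1, form_chartTranspose_apply sf x₀ hy.1,
              real_inner_comm]
          · rw [form_chartTranspose_apply sf x₀ hy.1, real_inner_self_eq_norm_sq]
            have := formTranspose_chart_ne_zero sf x₀ hy.1 (h4 y) hv
            positivity)
  -- **the almost complex structure `J := F(A, τ(A), p(A))`**
  -- the trace invariants and the polar formula on `End(ℝ⁴)`
  let τf : (E4 →L[ℝ] E4) → ℝ := fun B ↦ -(LinearMap.trace ℝ E4 ((B * B : E4 →L[ℝ] E4) : E4 →ₗ[ℝ] E4)) / 2
  let pf : (E4 →L[ℝ] E4) → ℝ := fun B ↦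
    (τf B) ^ 2 / 2 - LinearMap.trace ℝ E4 ((B * B * (B * B) : E4 →L[ℝ] E4) : E4 →ₗ[ℝ] E4) / 4
  let Φ : (E4 →L[ℝ] E4) → (E4 →L[ℝ] E4) := fun B ↦
    (√(pf B) * √(τf B + 2 * √(pf B)))⁻¹ • (B * (B * B + (τf B + √(pf B)) • 1))
  -- pointwise properties from `polar_spec`
  have hspec : ∀ x, 0 < pf (A x) ∧ 0 < τf (A x) + 2 * √(pf (A x)) ∧ Φ (A x) * Φ (A x) = -1 ∧
      ∀ v : TangentSpace (𝓡 4) x, v ≠ 0 → 0 < sf x ![v, Φ (A x) v] :=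
    fun x ↦ polar_spec (sf x) (A x) (hA x).1 (hA x).2.1 rfl rfl
  -- smoothness and equivariance of `Φ`
  have hΦs : ∀ x, ContDiffAt ℝ ∞ Φ (A x) := fun x ↦
    contDiffAt_polar contDiff_tauTrace.contDiffAt contDiff_pTrace.contDiffAt (hspec x).1 (hspec x).2.1
  have hΦc : ∀ (T T' : E4 →L[ℝ] E4), T.comp T' = ContinuousLinearMap.id ℝ E4 →
      T'.comp T = ContinuousLinearMap.id ℝ E4 → ∀ L : E4 →L[ℝ] E4,
      Φ (T.comp (L.comp T')) = T.comp ((Φ L).comp T') := by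
    intro T T' _ hT'T L
    have h : T' * T = 1 := hT'T
    show Φ (T * (L * T')) = T * (Φ L * T')
    have e1 : τf (T * (L * T')) = τf L := tauTrace_conj T T' L h
    have e2 : pf (T * (L * T')) = pf L := pTrace_conj T T' L h
    show (√(pf (T * (L * T'))) * √(τf (T * (L * T')) + 2 * √(pf (T * (L * T')))))⁻¹ •
        (T * (L * T') * (T * (L * T') * (T * (L * T')) + (τf (T * (L * T')) + √(pf (T * (L * T')))) • 1)) =
      T * ((√(pf L) * √(τf L + 2 * √(pf L)))⁻¹ • (L * (L * L + (τf L + √(pf L)) • 1)) * T')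
    rw [e1, e2]
    exact polar_conj T T' L h _ _
  let J : AlmostComplexStructure (𝓡 4) ∞ M :=
    { toFun := fun x ↦ Φ (A x)
      map_map' := fun x v ↦ by
        have := congrArg (fun B : E4 →L[ℝ] E4 ↦ B v) (hspec x).2.2.1
        exact this
      contMDiff' := contMDiff_endSection_map A.contMDiff hΦs hΦc }
  refine ⟨max R 0 + 2, J, by linarith, by linarith, fun x v hv ↦ (hspec x).2.2.2 v hv, ?_⟩
  -- **`J = J_ψ` beyond `R₁`**, hence `dψ (J v) = (i ⊕ i) (dψ v)`
  intro x hx hRx v a ha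
  have hxF : x ∈ F := ⟨hx, by linarith⟩
  set XE : E4 →L[ℝ] E4 := (mfderiv (𝓡 4) 𝓘(ℝ, E4) ψ x : E4 →L[ℝ] E4).inverse.comp
    (stdComplexStructure.comp (mfderiv (𝓡 4) 𝓘(ℝ, E4) ψ x : E4 →L[ℝ] E4)) with hXE
  have hAx : A x = XE := (hA x).2.2 hxF
  have hsq : XE * XE = -1 := pullbackJ_mul_self (hinv x hx)
  have key : Φ XE = XE := by
    have e1 : τf XE = 2 := tauTrace_of_mul_self hsq
    have e2 : pf XE = 1 := by
      show (τf XE) ^ 2 / 2 - _ = 1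
      exact pTrace_of_mul_self hsq
    calc Φ XE = (√(pf XE) * √(τf XE + 2 * √(pf XE)))⁻¹ •
          (XE * (XE * XE + (τf XE + √(pf XE)) • 1)) := rfl
      _ = (√(1 : ℝ) * √((2 : ℝ) + 2 * √(1 : ℝ)))⁻¹ •
          (XE * (XE * XE + ((2 : ℝ) + √(1 : ℝ)) • 1)) := by rw [e1, e2]
      _ = XE := polar_of_mul_self XE hsq
  have hJv : J x v = XE v := by
    show Φ (A x) v = XE v
    rw [hAx, key]
  rw [hJv, ha]
  exact apply_pullbackJ (hinv x hx) v

end Summit.SmoothPoincare4.SmoothPoincare4.Theorems.GromovRecognitionRelEnd.CrossCapLaurent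

end
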